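import Literature.NumberTheory.GaloisRepresentations.PicardLambdaAdicRepWeil
import Literature.NumberTheory.GaloisRepresentations.SuperellipticPointPlaces
import HarnessLib

/-!
# Places of `Ω(C_f)` fixed by a power of Frobenius, and the numbers `N_m(k(C_f))`

Topic `Literature/NumberTheory/GaloisRepresentations` (the superelliptic curves `C_f : y^p = f(x)` of
`SuperellipticFunctionField`).  **Proof file** (theorems only; D-0014/D-0026: no definitions, no named
facts).  Let `k = 𝔽_q`, `Ω ⊇ k` algebraically closed, `p` a prime with `p ≠ 0` in `k`, `f ∈ k[X]`
separable with `p ∤ deg f`, and `φ ∈ Aut(Ω/k)` the `q`-Frobenius (`φ x = x^q`), acting on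
`Ω(C_f) = Ω(x)[y]/(y^p - f)` through the coefficients and hence on its places.

* `nonempty_fixedPlaces_equiv_option` — for ANY automorphism `σ` of `Ω/k`, the places of `Ω(C_f)/Ω`
  fixed by `σ` are the place at infinity together with the places `Q_{(a,b)}` of the affine points
  `(a, b)`, `b^p = f(a)`, with `σ a = a`, `σ b = b` (classification of places `SuperellipticPointPlaces`:
  `σ Q_{(a,b)} = Q_{(σ a, σ b)}`, `Q_{(a,b)}` determines `(a, b)`, and `σ ∞ = ∞`).
* `natCard_fixedPlaces_frobenius_pow` — for `σ = φ^m` and any finite field `K'` with `#K' = q^m` mapped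
  into `Ω` over `k` (its image is the fixed field of `x ↦ x^{q^m}`):
  `#{Q : φ^m Q = Q} = #{(a, b) ∈ K'² : b^p = f(a)} + 1`.
* `natCard_fixedPlaces_frobenius_pow_eq_pointCount` — **`#{Q : φ^m Q = Q} = N_m(k(C_f))`** (`m ≥ 1`),
  the number of `𝔽_{q^m}`-rational points of `C_f` in the sense of Stichtenoth (5.40)
  (`N_m = ∑_{d ∣ m} d B_d`, the tree's `pointCount`), by the tree's
  `pointCount_natDegree_superelliptic` (`N_m = #{(a, b) ∈ 𝔽_{q^m}² : b^p = f(a)} + 1`, `𝔽_{q^m} = k[X]/(ψ)`).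

This is the fixed-point side of the Lefschetz/Weil trace formula for all iterates of Frobenius
(Milne, *Jacobian varieties*, §11, proof of Thm. 11.1: "`N_m` is the number of fixed points of
`π^m` acting on `C(k̄)`"), with no hypothesis `μ_p ⊆ k` (contrast `card_fixedPlaces_frobenius_deck` of
`SuperellipticTwistedFixedPlaces`, which counts the places fixed by a deck-twisted Frobenius through
Euler's criterion and needs `p ∣ q - 1`).

## References
* J. S. Milne, *Jacobian varieties*, in: Arithmetic Geometry (Cornell–Silverman eds.), Springer (1986),
  §11, Thm. 11.1 and its proof (PDF p. 272 of the held copy `book:cornellnd-arithmetic-geometry`).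
  [Milne1986JacobianVarieties]
* H. Stichtenoth, *Algebraic Function Fields and Codes*, 2nd ed., GTM 254 (2009), Lemma 3.5.2,
  Prop. 3.7.3, Lemma 5.1.9 (d), eq. (5.40). [Stichtenoth2009]
-/

noncomputable section

open Polynomial
open scoped Classical

namespace Literature.NumberTheory.GaloisRepresentations

open Literature.NumberTheory.DiophantineGeometry Literature.NumberTheory.DiophantineGeometry.AlgFunctionField

universe u v w

namespace SuperellipticFunctionField

variable {k : Type u} [Field k] {Ω : Type v} [Field Ω] [Algebra k Ω] {p : ℕ} [hp : Fact p.Prime] {f : k[X]}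
variable [Fact (Irreducible (superellipticPoly k Ω p f))]

/-! ### Places fixed by an automorphism of the constants -/

section AnyAut

variable {G : Type w} [Group G] [MulSemiringAction G Ω] [SMulCommClass G k Ω] [IsAlgClosed Ω]

/-- **The places of `Ω(C_f)` fixed by an automorphism `σ` of `Ω/k`** are `∞_C` and the places `Q_{(a,b)}` of
the `σ`-fixed affine points `(a, b)` of `C_f` (`b^p = f(a)`, `σ a = a`, `σ b = b`): an explicit bijection
`{Q : σ Q = Q} ≃ {∞} ⊔ {(a, b) : b^p = f(a), σ a = a, σ b = b}`.  (`σ Q_{(a,b)} = Q_{(σa,σb)}`,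
`smul_pointPlace`; `Q_{(a,b)}` determines `(a, b)`, `pointPlace_inj`; every place is `∞_C` or some
`Q_{(a,b)}`, `eq_inftyPlace_or_exists_eq_pointPlace`; `σ ∞_C = ∞_C`, `smul_inftyPlace`.)
[cite: Stichtenoth2009, Lemma 3.5.2, Prop. 3.7.3] [cite: Milne1986JacobianVarieties, §11 (proof of Thm. 11.1)] -/
theorem nonempty_fixedPlaces_equiv_option {ζ₀ : Ω} (hζ₀ : IsPrimitiveRoot ζ₀ p) (hsep : f.Separable)
    (hndvd : ¬ p ∣ f.natDegree) (σ : G) :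
    Nonempty ({Q : PlaceOver Ω (SuperellipticFunctionField k Ω p f) // σ • Q = Q} ≃
      Option {ab : Ω × Ω // ab.2 ^ p = (f.map (algebraMap k Ω)).eval ab.1 ∧ σ • ab.1 = ab.1 ∧ σ • ab.2 = ab.2}) := by
  -- the map from `{∞} ⊔ {fixed points}` to fixed places
  let g : Option {ab : Ω × Ω // ab.2 ^ p = (f.map (algebraMap k Ω)).eval ab.1 ∧ σ • ab.1 = ab.1 ∧ σ • ab.2 = ab.2} →
      {Q : PlaceOver Ω (SuperellipticFunctionField k Ω p f) // σ • Q = Q} := fun o =>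
    match o with
    | none => ⟨inftyPlace k Ω p f, smul_inftyPlace hndvd σ⟩
    | some ab => ⟨pointPlace k Ω p f ab.1.1 ab.1.2, by
        rw [smul_pointPlace hζ₀ hsep σ ab.2.1, ab.2.2.1, ab.2.2.2]⟩
  have hg_none : (g none).1 = inftyPlace k Ω p f := rfl
  have hg_some : ∀ ab, (g (some ab)).1 = pointPlace k Ω p f ab.1.1 ab.1.2 := fun ab => rfl
  refine ⟨(Equiv.ofBijective g ⟨?_, ?_⟩).symm⟩
  · -- injective
    rintro (_ | ab) (_ | ab') h
    · rfl
    · exact absurd (congrArg Subtype.val h).symm (hg_some ab' ▸ hg_none ▸ pointPlace_ne_inftyPlace hζ₀ hsep ab'.2.1)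
    · exact absurd (congrArg Subtype.val h) (hg_some ab ▸ hg_none ▸ pointPlace_ne_inftyPlace hζ₀ hsep ab.2.1)
    · have h' : pointPlace k Ω p f ab.1.1 ab.1.2 = pointPlace k Ω p f ab'.1.1 ab'.1.2 := by
        rw [← hg_some ab, ← hg_some ab', h]
      obtain ⟨h1, h2⟩ := pointPlace_inj hζ₀ hsep ab.2.1 ab'.2.1 h'
      congr 1
      exact Subtype.ext (Prod.ext h1 h2)
  · -- surjective
    rintro ⟨Q, hQ⟩
    rcases eq_inftyPlace_or_exists_eq_pointPlace hζ₀ hsep hndvd Q with rfl | ⟨a, b, hb, rfl⟩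
    · exact ⟨none, rfl⟩
    · have hfix : pointPlace k Ω p f (σ • a) (σ • b) = pointPlace k Ω p f a b := by
        rw [← smul_pointPlace hζ₀ hsep σ hb]; exact hQ
      obtain ⟨ha, hb'⟩ := pointPlace_inj hζ₀ hsep (pow_eq_eval_smul σ hb) hb hfix
      exact ⟨some ⟨(a, b), hb, ha, hb'⟩, rfl⟩

/-- **`#{Q : σ Q = Q} = #{(a, b) : b^p = f(a), σ a = a, σ b = b} + 1`** whenever the set of `σ`-fixed affine
points of `C_f` is finite. [cite: Milne1986JacobianVarieties, §11 (proof of Thm. 11.1)] -/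
theorem natCard_fixedPlaces_eq_natCard_add_one {ζ₀ : Ω} (hζ₀ : IsPrimitiveRoot ζ₀ p) (hsep : f.Separable)
    (hndvd : ¬ p ∣ f.natDegree) (σ : G)
    [Finite {ab : Ω × Ω // ab.2 ^ p = (f.map (algebraMap k Ω)).eval ab.1 ∧ σ • ab.1 = ab.1 ∧ σ • ab.2 = ab.2}] :
    Nat.card {Q : PlaceOver Ω (SuperellipticFunctionField k Ω p f) // σ • Q = Q} =
      Nat.card {ab : Ω × Ω // ab.2 ^ p = (f.map (algebraMap k Ω)).eval ab.1 ∧ σ • ab.1 = ab.1 ∧ σ • ab.2 = ab.2} + 1 := by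
  obtain ⟨e⟩ := nonempty_fixedPlaces_equiv_option (k := k) (p := p) (f := f) hζ₀ hsep hndvd σ
  rw [Nat.card_congr e, Finite.card_option]

end AnyAut

/-! ### Places fixed by `φ^m` and the points over `𝔽_{q^m}` -/

section Frobenius

variable [Fintype k] [IsAlgClosed Ω]

omit hp [Fact (Irreducible (superellipticPoly k Ω p f))] [IsAlgClosed Ω] in
/-- **The image of `𝔽_{q^m}` in `Ω` is the fixed field of `x ↦ x^{q^m}`**: for a finite field `K'` with
`#K' = q^m`, mapped into `Ω` over `k`, and the `q`-Frobenius `φ`, an element `x ∈ Ω` satisfies `φ^m x = x`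
iff `x` comes from `K'`. [folklore] -/
theorem algEquiv_pow_apply_eq_self_iff (φ : Ω ≃ₐ[k] Ω) (hφ : ∀ x : Ω, φ x = x ^ Fintype.card k)
    {K' : Type w} [Field K'] [Fintype K'] [Algebra K' Ω] {m : ℕ} (hK' : Fintype.card K' = Fintype.card k ^ m)
    (x : Ω) : (φ ^ m) x = x ↔ ∃ c : K', algebraMap K' Ω c = x := by
  rw [algEquiv_pow_apply_eq_pow_card_pow φ hφ m x, ← hK']
  constructor
  · exact exists_eq_algebraMap_of_pow_card_eq
  · rintro ⟨c, rfl⟩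
    rw [← map_pow, FiniteField.pow_card]

omit hp [Fact (Irreducible (superellipticPoly k Ω p f))] [IsAlgClosed Ω] [Fintype k] in
/-- `f_Ω(c) = f_{K'}(c)` in `Ω` for `c ∈ K'` (`k → K' → Ω` a tower). [folklore] -/
theorem eval_map_algebraMap_tower {K' : Type w} [Field K'] [Algebra k K'] [Algebra K' Ω] [IsScalarTower k K' Ω]
    (c : K') : (f.map (algebraMap k Ω)).eval (algebraMap K' Ω c) =
      algebraMap K' Ω ((f.map (algebraMap k K')).eval c) := by
  rw [IsScalarTower.algebraMap_eq k K' Ω, ← Polynomial.map_map, eval_map, eval₂_at_apply]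

omit hp [Fact (Irreducible (superellipticPoly k Ω p f))] [IsAlgClosed Ω] in
/-- **The `φ^m`-fixed affine points of `C_f` over `Ω` are its `𝔽_{q^m}`-points**: an explicit bijection with
`{(a, b) ∈ K'² : b^p = f(a)}` for any finite field `K'` with `#K' = q^m` inside `Ω` (over `k`).
[cite: Stichtenoth2009, Lemma 5.1.9 (d)] -/
theorem nonempty_fixedPoints_equiv (φ : Ω ≃ₐ[k] Ω) (hφ : ∀ x : Ω, φ x = x ^ Fintype.card k)
    {K' : Type w} [Field K'] [Fintype K'] [Algebra k K'] [Algebra K' Ω] [IsScalarTower k K' Ω] {m : ℕ}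
    (hK' : Fintype.card K' = Fintype.card k ^ m) :
    Nonempty ({ab : K' × K' // ab.2 ^ p = (f.map (algebraMap k K')).eval ab.1} ≃
      {ab : Ω × Ω // ab.2 ^ p = (f.map (algebraMap k Ω)).eval ab.1 ∧ (φ ^ m) • ab.1 = ab.1 ∧ (φ ^ m) • ab.2 = ab.2}) := by
  set ι := algebraMap K' Ω with hι
  let g : {ab : K' × K' // ab.2 ^ p = (f.map (algebraMap k K')).eval ab.1} →
      {ab : Ω × Ω // ab.2 ^ p = (f.map (algebraMap k Ω)).eval ab.1 ∧ (φ ^ m) • ab.1 = ab.1 ∧ (φ ^ m) • ab.2 = ab.2} :=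
    fun ab => ⟨(ι ab.1.1, ι ab.1.2), by
      refine ⟨?_, ?_, ?_⟩
      · change ι ab.1.2 ^ p = (f.map (algebraMap k Ω)).eval (ι ab.1.1)
        rw [eval_map_algebraMap_tower, ← map_pow, ab.2]
      · exact (algEquiv_pow_apply_eq_self_iff φ hφ hK' _).2 ⟨ab.1.1, rfl⟩
      · exact (algEquiv_pow_apply_eq_self_iff φ hφ hK' _).2 ⟨ab.1.2, rfl⟩⟩
  have hg : ∀ ab, (g ab).1 = (ι ab.1.1, ι ab.1.2) := fun ab => rfl
  refine ⟨Equiv.ofBijective g ⟨?_, ?_⟩⟩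
  · intro ab ab' h
    have h' := congrArg Subtype.val h
    rw [hg, hg, Prod.mk.injEq] at h'
    exact Subtype.ext (Prod.ext (ι.injective h'.1) (ι.injective h'.2))
  · rintro ⟨⟨a, b⟩, hb, ha, hb'⟩
    obtain ⟨a', rfl⟩ := (algEquiv_pow_apply_eq_self_iff φ hφ hK' a).1 ha
    obtain ⟨b', rfl⟩ := (algEquiv_pow_apply_eq_self_iff φ hφ hK' b).1 hb'
    refine ⟨⟨(a', b'), ?_⟩, Subtype.ext rfl⟩
    apply ι.injective
    rw [map_pow, ← eval_map_algebraMap_tower]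
    exact hb

/-- **`#{Q : φ^m Q = Q} = #{(a, b) ∈ 𝔽_{q^m}² : b^p = f(a)} + 1`**: the places of `Ω(C_f)` fixed by the `m`-th
power of the `q`-Frobenius are `∞_C` and the places of the `𝔽_{q^m}`-rational affine points of `C_f`
(`K'` any finite field with `q^m` elements inside `Ω`, over `k`).  No hypothesis `μ_p ⊆ k` is needed.
[cite: Milne1986JacobianVarieties, §11 (proof of Thm. 11.1)] [cite: Stichtenoth2009, Lemma 5.1.9 (d)] -/
theorem natCard_fixedPlaces_frobenius_pow (φ : Ω ≃ₐ[k] Ω) (hφ : ∀ x : Ω, φ x = x ^ Fintype.card k)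
    (hpk : (p : k) ≠ 0) (hsep : f.Separable) (hndvd : ¬ p ∣ f.natDegree)
    {K' : Type w} [Field K'] [Fintype K'] [Algebra k K'] [Algebra K' Ω] [IsScalarTower k K' Ω] {m : ℕ}
    (hK' : Fintype.card K' = Fintype.card k ^ m) :
    Nat.card {Q : PlaceOver Ω (SuperellipticFunctionField k Ω p f) // (φ ^ m) • Q = Q} =
      Fintype.card {ab : K' × K' // ab.2 ^ p = (f.map (algebraMap k K')).eval ab.1} + 1 := by
  haveI : NeZero ((p : ℕ) : Ω) := ⟨by rwa [Ne, ← map_natCast (algebraMap k Ω), map_eq_zero]⟩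
  obtain ⟨ζ₀, hζ₀⟩ := HasEnoughRootsOfUnity.exists_primitiveRoot Ω p
  obtain ⟨e⟩ := nonempty_fixedPoints_equiv (p := p) (f := f) φ hφ hK'
  haveI : Finite {ab : Ω × Ω // ab.2 ^ p = (f.map (algebraMap k Ω)).eval ab.1 ∧ (φ ^ m) • ab.1 = ab.1 ∧
      (φ ^ m) • ab.2 = ab.2} := Finite.of_equiv _ e
  rw [natCard_fixedPlaces_eq_natCard_add_one hζ₀ hsep hndvd (φ ^ m), ← Nat.card_congr e, Nat.card_eq_fintype_card]

/-- **`#{Q : φ^m Q = Q} = N_m(k(C_f))`** (`m ≥ 1`): the number of places of `Ω(C_f)/Ω` fixed by the `m`-th power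
of the `q`-Frobenius is the number `N_m = ∑_{d ∣ m} d B_d` of `𝔽_{q^m}`-rational points of the curve with
function field `k(C_f)/k` (Stichtenoth (5.40), the tree's `pointCount`) — the fixed-point side of the trace
formula for `π^m` (Milne, proof of Thm. 11.1).  Proof: realise `𝔽_{q^m}` as `k[X]/(ψ)` inside `Ω`
(`ψ` irreducible of degree `m`) and combine `natCard_fixedPlaces_frobenius_pow` with
`pointCount_natDegree_superelliptic`.
[cite: Milne1986JacobianVarieties, §11 Thm. 11.1 (proof)] [cite: Stichtenoth2009, Lemma 5.1.9 (d), eq. (5.40)] -/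
theorem natCard_fixedPlaces_frobenius_pow_eq_pointCount [Algebra.IsAlgebraic k Ω]
    [Fact (Irreducible (superellipticPoly k k p f))] (φ : Ω ≃ₐ[k] Ω) (hφ : ∀ x : Ω, φ x = x ^ Fintype.card k)
    (hpk : (p : k) ≠ 0) (hsep : f.Separable) (hndvd : ¬ p ∣ f.natDegree) {m : ℕ} (hm : 0 < m) :
    Nat.card {Q : PlaceOver Ω (SuperellipticFunctionField k Ω p f) // (φ ^ m) • Q = Q} =
      pointCount k (SuperellipticFunctionField k k p f) m := by
  obtain ⟨ψ, -, hirr, -, hψdeg⟩ := exists_irreducible_natDegree_eq k hm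
  haveI : Fact (Irreducible ψ) := ⟨hirr⟩
  letI : Fintype (AdjoinRoot ψ) := Fintype.ofFinite _
  letI : Algebra (AdjoinRoot ψ) Ω := (IsAlgClosed.lift : AdjoinRoot ψ →ₐ[k] Ω).toRingHom.toAlgebra
  haveI : IsScalarTower k (AdjoinRoot ψ) Ω :=
    IsScalarTower.of_algebraMap_eq fun x => ((IsAlgClosed.lift : AdjoinRoot ψ →ₐ[k] Ω).commutes x).symm
  have hdeg : 0 < f.natDegree := Nat.pos_of_ne_zero fun h => hndvd (by rw [h]; exact dvd_zero p)
  have hsep' : (f.map (algebraMap k (AdjoinRoot ψ))).Separable := hsep.map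
  have hdeg' : 0 < (f.map (algebraMap k (AdjoinRoot ψ))).natDegree := by rwa [natDegree_map]
  haveI : Fact (Irreducible (superellipticPoly (AdjoinRoot ψ) (AdjoinRoot ψ) p (f.map (algebraMap k (AdjoinRoot ψ))))) :=
    fact_irreducible_superellipticPoly _ _ _ hsep' hdeg'
  have hcardK' : Fintype.card (AdjoinRoot ψ) = Fintype.card k ^ m := by
    rw [← Nat.card_eq_fintype_card, natCard_adjoinRoot, Nat.card_eq_fintype_card, hψdeg]
  rw [natCard_fixedPlaces_frobenius_pow φ hφ hpk hsep hndvd hcardK',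
    ← hψdeg, pointCount_natDegree_superelliptic (k := k) (p := p) (f := f) ψ hpk hsep hndvd,
    Nat.card_eq_fintype_card]

/-- The case `m = 1`: **`#{Q : φ Q = Q} = N_1(k(C_f)) = #{(a, b) ∈ k² : b^p = f(a)} + 1`**, for every finite
field `k` with `p ≠ 0` in `k` (no roots of unity required). [cite: Milne1986JacobianVarieties, §11 Thm. 11.1 (proof)]
[cite: Stichtenoth2009, eq. (5.40)] -/
theorem natCard_fixedPlaces_frobenius_eq_pointCount_one [Algebra.IsAlgebraic k Ω]
    [Fact (Irreducible (superellipticPoly k k p f))] (φ : Ω ≃ₐ[k] Ω) (hφ : ∀ x : Ω, φ x = x ^ Fintype.card k)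
    (hpk : (p : k) ≠ 0) (hsep : f.Separable) (hndvd : ¬ p ∣ f.natDegree) :
    Nat.card {Q : PlaceOver Ω (SuperellipticFunctionField k Ω p f) // φ • Q = Q} =
      pointCount k (SuperellipticFunctionField k k p f) 1 := by
  rw [← natCard_fixedPlaces_frobenius_pow_eq_pointCount φ hφ hpk hsep hndvd Nat.one_pos, pow_one]

end Frobenius

end SuperellipticFunctionField

end Literature.NumberTheory.GaloisRepresentations
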